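import Mathlib

/-! # ValueCycle-v1 — the VALUE-CYCLE COUNT: up-crossings = down-crossings on a chained cycle; runs(ω) = P + desc(ω) − asc(ω); the pigeonhole
sub-case «fewer excursions than poles ⇒ every value lies on a run» (lens-1 g8; (CA814)/(CA822) «type the pigeonhole sub-case as a (K) lemma»;
NODE v23 §1–§2)

PURE BOOKKEEPING, Mathlib only, 0 sorries, no law.  This is the combinatorial skeleton of the petal-boundary / circle-value identity of NODE v23:
a closed boundary walk is a cyclic sequence of `n` pieces with start/finish values in `EReal`, CHAINED (finish of piece `i` = start of piece
`i+1`, cyclically).  In the geometric instantiation (NOT typed here; it is the analytic input): RUNS are level arcs / NL base segments along which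
`φ₀` is real and increasing (start < finish), POLES are zeros of `G` on the boundary (passage `+∞ → −∞`: start `⊤`, finish `⊥`), EXCURSIONS are
arcs of the Jensen circle along which `Im φ₀ > 0` (start = entry value, finish = exit value).  For a generic real `ω` (not an endpoint value):
* `upAt_eq_downAt`: `#{i : start i < ω < finish i} = #{i : finish i < ω < start i}` — kind-free telescoping (`χ_ω(finish i) − χ_ω(start i)` sums to 0).
* `runs_eq`: with the three kinds, `runs(ω) = poles + desc(ω) − asc(ω)` (as `ℤ`-valued indicator sums).
* ★ `exists_run_of_exc_lt_poles`: if the cycle has FEWER excursion pieces than pole pieces, every generic `ω` lies strictly inside some run —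
  the pigeonhole sub-case of the value-covering / circle value law (NODE v22 §4, v23 §2): there it yields a payer (child on a level arc or NL event)
  of value `ω = −g` for EVERY tilt `g`.
Nothing here bears on the truth of RH; RH is not proved; 33346/33347 OPEN; checked ≠ landed ≠ proved. -/

namespace RhW08.Lens1ValueCycle

open Finset

/-- The three kinds of boundary pieces of a positive nodal cell: runs (real, increasing), poles (`+∞ → −∞`), excursions (circle arcs). -/
inductive PieceKind
  /-- a run: a level arc or NL base segment, `φ₀` real and increasing -/
  | run
  /-- a pole: a zero of `G` on the boundary, passage `⊤ → ⊥` -/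
  | pole
  /-- an excursion: an arc of the Jensen circle with `Im φ₀ > 0` -/
  | exc

/-- Boolean test: is the piece a run? (pattern-matching def; no instances) -/
def PieceKind.isRun : PieceKind → Bool
  | .run => true
  | _ => false

/-- Boolean test: is the piece a pole? -/
def PieceKind.isPole : PieceKind → Bool
  | .pole => true
  | _ => false

/-- Boolean test: is the piece an excursion? -/
def PieceKind.isExc : PieceKind → Bool
  | .exc => true
  | _ => false

/-- A cyclic boundary walk with `n` pieces: kinds and `EReal` start/finish values. -/
structure ValueCycle (n : ℕ) where
  /-- kind of piece `i` -/
  kind : Fin n → PieceKind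
  /-- value at the start of piece `i` -/
  start : Fin n → EReal
  /-- value at the end of piece `i` -/
  finish : Fin n → EReal

variable {n : ℕ}

/-- Chained: each piece ends where the next one starts (cyclically). -/
def IsChained [NeZero n] (c : ValueCycle n) : Prop := ∀ i : Fin n, c.finish i = c.start (i + 1)

/-- Well-formed kinds: runs increase, poles pass from `⊤` to `⊥`. -/
def WellFormed (c : ValueCycle n) : Prop :=
  (∀ i, c.kind i = PieceKind.run → c.start i < c.finish i) ∧ (∀ i, c.kind i = PieceKind.pole → c.start i = ⊤ ∧ c.finish i = ⊥)

/-- `ω` is generic: not an endpoint value of any piece. -/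
def Generic (ω : ℝ) (c : ValueCycle n) : Prop := ∀ i, (ω : EReal) ≠ c.start i ∧ (ω : EReal) ≠ c.finish i

/-- The level indicator `χ_ω(v) = [ω < v]`. -/
noncomputable def levelChi (ω : ℝ) (v : EReal) : ℤ := if (ω : EReal) < v then 1 else 0

/-- Up-crossing indicator of piece `i` at level `ω`: `[start i < ω < finish i]`. -/
noncomputable def upAt (ω : ℝ) (c : ValueCycle n) (i : Fin n) : ℤ := if c.start i < ω ∧ (ω : EReal) < c.finish i then 1 else 0

/-- Down-crossing indicator of piece `i` at level `ω`: `[finish i < ω < start i]`. -/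
noncomputable def downAt (ω : ℝ) (c : ValueCycle n) (i : Fin n) : ℤ := if c.finish i < ω ∧ (ω : EReal) < c.start i then 1 else 0

/-- (K) one piece: `χ_ω(finish) − χ_ω(start) = upAt − downAt` for generic `ω` (kind-free). -/
theorem levelChi_sub_levelChi {ω : ℝ} {s f : EReal} (hs : (ω : EReal) ≠ s) (hf : (ω : EReal) ≠ f) :
    levelChi ω f - levelChi ω s = (if s < ω ∧ (ω : EReal) < f then 1 else 0) - (if f < ω ∧ (ω : EReal) < s then 1 else 0) := by
  unfold levelChi
  rcases lt_or_gt_of_ne hs with h1 | h1 <;> rcases lt_or_gt_of_ne hf with h2 | h2 <;>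
    simp [h1, h2, not_lt.2 h1.le, not_lt.2 h2.le]

/-- (K) telescoping on a chained cycle: `Σ_i (χ_ω(finish i) − χ_ω(start i)) = 0`. -/
theorem sum_levelChi_sub_eq_zero [NeZero n] (c : ValueCycle n) (hc : IsChained c) (ω : ℝ) :
    ∑ i, (levelChi ω (c.finish i) - levelChi ω (c.start i)) = 0 := by
  rw [Finset.sum_sub_distrib]
  have h : ∑ i, levelChi ω (c.finish i) = ∑ i, levelChi ω (c.start i) := by
    have h1 : (fun i => levelChi ω (c.finish i)) = fun i => levelChi ω (c.start (i + 1)) := funext fun i => by rw [hc i]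
    rw [h1]
    exact Fintype.sum_equiv (Equiv.addRight 1) _ _ (fun i => rfl)
  rw [h]; exact sub_self _

/-- ★ (K) UP = DOWN: on a chained cycle, for generic `ω`, the number of pieces crossing `ω` upward equals the number crossing it downward. -/
theorem upAt_eq_downAt [NeZero n] (c : ValueCycle n) (hc : IsChained c) {ω : ℝ} (hg : Generic ω c) :
    ∑ i, upAt ω c i = ∑ i, downAt ω c i := by
  have h0 := sum_levelChi_sub_eq_zero c hc ω
  have h1 : ∀ i, levelChi ω (c.finish i) - levelChi ω (c.start i) = upAt ω c i - downAt ω c i :=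
    fun i => by rw [levelChi_sub_levelChi (hg i).1 (hg i).2]; rfl
  simp_rw [h1, Finset.sum_sub_distrib] at h0
  linarith

/-- Run indicator at `ω`: piece `i` is a run containing `ω`. -/
noncomputable def runsAt (ω : ℝ) (c : ValueCycle n) (i : Fin n) : ℤ := if (c.kind i).isRun then upAt ω c i else 0
/-- Ascending-excursion indicator at `ω`. -/
noncomputable def ascAt (ω : ℝ) (c : ValueCycle n) (i : Fin n) : ℤ := if (c.kind i).isExc then upAt ω c i else 0
/-- Descending-excursion indicator at `ω`. -/
noncomputable def descAt (ω : ℝ) (c : ValueCycle n) (i : Fin n) : ℤ := if (c.kind i).isExc then downAt ω c i else 0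
/-- Pole indicator. -/
def poleAt (c : ValueCycle n) (i : Fin n) : ℤ := if (c.kind i).isPole then 1 else 0
/-- Excursion indicator. -/
def excAt (c : ValueCycle n) (i : Fin n) : ℤ := if (c.kind i).isExc then 1 else 0

/-- (K) piecewise reading of `upAt`/`downAt` by kind on a well-formed cycle. -/
theorem upAt_sub_downAt_eq (c : ValueCycle n) (hw : WellFormed c) (ω : ℝ) (i : Fin n) :
    upAt ω c i - downAt ω c i = runsAt ω c i + ascAt ω c i - descAt ω c i - poleAt c i := by
  unfold runsAt ascAt descAt poleAt
  rcases hk : c.kind i with _ | _ | _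
  · -- run: `start < finish`, so no downAt-crossing
    have hlt := hw.1 i hk
    have hd : downAt ω c i = 0 := by
      unfold downAt; rw [if_neg]; rintro ⟨h1, h2⟩; exact lt_asymm hlt (h1.trans h2)
    simp [hd, PieceKind.isRun, PieceKind.isPole, PieceKind.isExc]
  · -- pole: `⊤ → ⊥`, one downAt-crossing, no upAt-crossing
    obtain ⟨hs, hf⟩ := hw.2 i hk
    have hu : upAt ω c i = 0 := by unfold upAt; rw [if_neg]; rw [hs]; rintro ⟨h1, _⟩; exact (not_top_lt h1).elim
    have hd : downAt ω c i = 1 := by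
      unfold downAt; rw [if_pos]; rw [hs, hf]; exact ⟨EReal.bot_lt_coe ω, EReal.coe_lt_top ω⟩
    simp [hu, hd, PieceKind.isRun, PieceKind.isPole, PieceKind.isExc]
  · simp [PieceKind.isRun, PieceKind.isPole, PieceKind.isExc]

/-- ★ (K) RUNS COUNT: on a chained well-formed cycle, for generic `ω`: `runs(ω) = poles + desc(ω) − asc(ω)`. -/
theorem runs_eq [NeZero n] (c : ValueCycle n) (hc : IsChained c) (hw : WellFormed c) {ω : ℝ} (hg : Generic ω c) :
    ∑ i, runsAt ω c i = ∑ i, poleAt c i + ∑ i, descAt ω c i - ∑ i, ascAt ω c i := by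
  have h := upAt_eq_downAt c hc hg
  have h2 : ∑ i, (upAt ω c i - downAt ω c i) = ∑ i, (runsAt ω c i + ascAt ω c i - descAt ω c i - poleAt c i) :=
    Finset.sum_congr rfl fun i _ => upAt_sub_downAt_eq c hw ω i
  simp only [Finset.sum_sub_distrib, Finset.sum_add_distrib] at h2
  linarith

/-- (K) ascending excursions are excursions: `asc(ω) ≤ #exc`. -/
theorem sum_ascAt_le (c : ValueCycle n) (ω : ℝ) : ∑ i, ascAt ω c i ≤ ∑ i, excAt c i := by
  refine Finset.sum_le_sum fun i _ => ?_
  unfold ascAt excAt upAt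
  split_ifs <;> simp

/-- (K) run indicators are `0/1`. -/
theorem runsAt_le_one (c : ValueCycle n) (ω : ℝ) (i : Fin n) : runsAt ω c i ≤ 1 ∧ 0 ≤ runsAt ω c i := by
  unfold runsAt upAt; split_ifs <;> simp

/-- (K) reading a kind off its Boolean test. -/
theorem PieceKind.eq_run_of_isRun : ∀ k : PieceKind, k.isRun = true → k = PieceKind.run := by
  intro k; cases k <;> simp [PieceKind.isRun]

/-- (K) a positive run indicator means: the piece is a run containing `ω`. -/
theorem run_of_runsAt_pos {ω : ℝ} {c : ValueCycle n} {i : Fin n} (h : 0 < runsAt ω c i) :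
    c.kind i = PieceKind.run ∧ c.start i < ω ∧ (ω : EReal) < c.finish i := by
  unfold runsAt upAt at h
  by_cases hr : (c.kind i).isRun = true
  · rw [if_pos hr] at h
    by_cases h1 : c.start i < ω ∧ (ω : EReal) < c.finish i
    · exact ⟨PieceKind.eq_run_of_isRun _ hr, h1.1, h1.2⟩
    · rw [if_neg h1] at h; exact absurd h (lt_irrefl 0)
  · rw [if_neg hr] at h; exact absurd h (lt_irrefl 0)

/-- ★ (K) PIGEONHOLE SUB-CASE: fewer excursion pieces than pole pieces ⇒ every generic level `ω` lies strictly inside some run. -/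
theorem exists_run_of_exc_lt_poles [NeZero n] (c : ValueCycle n) (hc : IsChained c) (hw : WellFormed c) {ω : ℝ} (hg : Generic ω c)
    (hlt : ∑ i, excAt c i < ∑ i, poleAt c i) :
    ∃ i : Fin n, c.kind i = PieceKind.run ∧ c.start i < ω ∧ (ω : EReal) < c.finish i := by
  have h := runs_eq c hc hw hg
  have ha := sum_ascAt_le c ω
  have hd : 0 ≤ ∑ i, descAt ω c i := Finset.sum_nonneg fun i _ => by unfold descAt downAt; split_ifs <;> simp
  have hpos : 0 < ∑ i, runsAt ω c i := by linarith
  obtain ⟨i, _, hi⟩ := Finset.exists_lt_of_sum_lt (by simpa using hpos : ∑ _i : Fin n, (0 : ℤ) < ∑ i, runsAt ω c i)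
  exact ⟨i, run_of_runsAt_pos hi⟩

/-- (K) one pole and no excursion (the mate-free, excursion-free petal): every generic value is on a run. -/
theorem exists_run_of_no_exc [NeZero n] (c : ValueCycle n) (hc : IsChained c) (hw : WellFormed c) {ω : ℝ} (hg : Generic ω c)
    (hexc : ∀ i, c.kind i ≠ PieceKind.exc) (hpole : ∃ i, c.kind i = PieceKind.pole) :
    ∃ i : Fin n, c.kind i = PieceKind.run ∧ c.start i < ω ∧ (ω : EReal) < c.finish i := by
  refine exists_run_of_exc_lt_poles c hc hw hg ?_
  have h0 : ∑ i, excAt c i = 0 := Finset.sum_eq_zero fun i _ => by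
    unfold excAt; rcases hk : c.kind i with _ | _ | _ <;> simp_all [PieceKind.isExc]
  obtain ⟨j, hj⟩ := hpole
  have h1 : poleAt c j ≤ ∑ i, poleAt c i :=
    Finset.single_le_sum (fun i _ => by unfold poleAt; split_ifs <;> simp) (Finset.mem_univ j)
  have h2 : poleAt c j = 1 := by unfold poleAt; rw [hj]; simp [PieceKind.isPole]
  linarith

end RhW08.Lens1ValueCycle
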